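import Mathlib.Analysis.SpecialFunctions.Pow.Asymptotics
import Mathlib.Analysis.SpecialFunctions.ExpDeriv
import Literature.Analysis.FluidPDE.GeneralizedAxisymNS
import HarnessLib

/-!
# Hou's two-scale dynamic rescaling of the (generalized) axisymmetric Navier–Stokes equations:
# exponent bookkeeping, the solution-dependent viscosity law, and the steady self-similar
# profile system

Topic `Literature/Analysis/FluidPDE`. Definitions with bodies and PROVED identities; the only data
recorded from the sources are printed numerical parameters (see *Constants*). No named facts.
Companion of `GeneralizedAxisymNS.lean`, which types §1–§2 of the same paper ("Not here: the
dynamic-rescaling / self-similar profile equations (§3)") — this file types §3.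

Sources (held; `p.` = chunk of the held text rendering):
* T. Y. Hou, *Nearly self-similar blowup of generalized axisymmetric Navier–Stokes equations*,
  Found. Comput. Math. (2026) = arXiv:2405.10916 [Hou2026], §1.1 (p. 2–3) and §3 "A novel two-scale
  dynamic rescaling formulation" (p. 10–11).
* T. Y. Hou, *The potentially singular behavior of the 3D Navier–Stokes equations*, Found. Comput.
  Math. 23 (2023) = arXiv:2107.06509 [Hou2022PotentiallySingularNS], §2 (setup), §3.4 (fitted
  scalings) — NUMERICS; recorded in docstrings only (see *Constants* and *WHAT THIS IS NOT*).

## What is printed (Hou 2026, §3)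

Dynamic rescaling `ũ₁(τ,ξ,η) = C_u(τ) u₁(t(τ), C_lr(τ)ξ, C_lz(τ)η)` (same for `ω₁, ψ₁` with
`C_ω, C_ψ`), `C_u = e^{∫₀^τ c_u}`, `C_ω = e^{∫ c_ω}`, `C_ψ = e^{∫ c_ψ}`, `C_lr = e^{−∫ c_lr}`,
`C_lz = e^{−∫ c_lz}`, `t(τ) = ∫₀^τ C_ψ C_lz` ("`dτ/dt = (C_ψ C_lz)⁻¹`"), and "the scaling parameters
`(c_lz, c_lr, c_ψ, c_u, c_ω)` satisfy the rescaling relationship `c_ψ = c_u + c_lz`,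
`c_ω = c_u − c_lz`". For CONSTANT exponents: "`C_ψ(τ) = e^{c_ψτ}`, `C_lz(τ) = e^{−c_lzτ}`, which implies
`t(τ) = (e^{(c_ψ−c_lz)τ} − 1)/(c_ψ − c_lz)` … `τ = log(1/(T−t))/(c_lz − c_ψ)` where
`T = 1/(c_lz − c_ψ)` … `C_lz(τ) = (T−t)^{ĉ_lz}`, `C_lr(τ) = (T−t)^{ĉ_lr}`, `ĉ_lz = c_lz/(c_lz − c_ψ)` …
The blowup rates are given by `1/C_u = 1/(T−t)`, `1/C_ω = 1/(T−t)^{1+ĉ_lz}`,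
`1/C_ψ = 1/(T−t)^{1−ĉ_lz}`, where `ĉ_ω = −1 − ĉ_lz` and `ĉ_ψ = −1 + ĉ_lz`." Solution-dependent
viscosity (§1.1: "`ν = ν₀‖u₁(t)‖_∞ Z(t)²` with `ν₀ = 0.006` … scaling invariant"; §3: "we note that
`‖u₁‖_∞ Z(t)²` … Thus, we have `νC_ψ/C_lz = ν₀`. As a result, the dynamic rescaling formulation
is the same as that for the generalized axisymmetric Navier–Stokes equations with a constant
viscosity `ν₀`"); §1.1: "`ν = ν₀‖u₁‖_∞Z(t)² = ν₀(T−t)^{2c_l−1}` since `Z(t) = (T−t)^{c_l}`",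
"`c_l = 0.5233`", "`n ≈ 3.188`". The steady state of the one-scale (`δ = 1`, `c_lr = c_lz = c_l`)
rescaled system is the **self-similar profile system** (§3, displayed after "the steady state
satisfies the following self-similar equations"), and "Due to the total circulation conservation
of the generalized Euler equations, we expect to have `c_l → 1/2` and `n → 3` in the limit
`ν₀ → 0`."

## Contents (all in `namespace Literature.Analysis.FluidPDE`)

* `HouScalingExponents` — the five constant exponents with the rescaling relationship; derived
  `κ = c_lz − c_ψ = −c_u` (`HouScalingExponents.kappa`), normalized exponents `ĉ_• = c_•/κ`
  (`….hat`), and the PROVED relations `ĉ_u = −1`, `ĉ_ω = −1 − ĉ_lz`, `ĉ_ψ = −1 + ĉ_lz`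
  (`hat_cu`, `hat_cω`, `hat_cψ`).
* `….factor c τ = e^{cτ}` (so `C_u = factor c_u`, …, `C_lz = factor (−c_lz)`), the rescaled time
  `….time τ = (e^{−κτ} − 1)/(−κ)` with `HasDerivAt time (C_ψ τ · C_lz τ) τ` (`hasDerivAt_time`: the
  printed `dτ/dt = (C_ψC_lz)⁻¹`), the blow-up time `T = 1/κ` and `T − t(τ) = e^{−κτ}/κ`
  (`blowupTime_sub_time`), `τ = log(1/(κ(T−t)))/κ` (`tau_eq_log`); the power laws
  `C_lz = (κ(T−t))^{ĉ_lz}`, `C_u⁻¹ = (κ(T−t))⁻¹`, `C_ω⁻¹ = (κ(T−t))^{−(1+ĉ_lz)}`,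
  `C_ψ⁻¹ = (κ(T−t))^{−(1−ĉ_lz)}` (`factor_neg_clz_eq_rpow`, `inv_factor_cu`, `inv_factor_cω`,
  `inv_factor_cψ`) — Hou's formulas with the harmless constant `κ = 1/T` made explicit.
* `….physicalViscosity ν₀ τ = ν₀ C_lz/C_ψ` — the physical viscosity that keeps the rescaled one equal
  to `ν₀` (`νC_ψ/C_lz = ν₀`), and `physicalViscosity_eq_rpow`: it equals `ν₀(κ(T−t))^{2ĉ_lz−1}` — the
  printed "`ν = ν₀(T−t)^{2c_l−1}`"; hence constant iff `ĉ_lz = ½`, and for `ĉ_lz > ½` it tends to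
  `0` at the blow-up time (`tendsto_physicalViscosity_zero`), which is the precise content of
  "WHAT THIS IS NOT: not constant-viscosity NS" for the reported `ĉ_l = 0.5233`
  (`tendsto_hou2026_viscosity_zero`).
* `HouSelfSimilarProfile n ν₀ cl cu U Ω Ψ` — the steady self-similar profile system in the tree's
  primary variables `(ũ₁, ω̃₁, ψ̃₁)` of `GeneralizedAxisymNS` (one-scale `δ = 1`, `c_lr = c_lz = c_l`,
  `c_ω = c_u − c_l`, constant rescaled viscosity `ν₀`), over the operators `derivR/derivZ`,
  `GeneralizedAxisymNS.lap/radialVel/axialVel` of `GeneralizedAxisymNS.lean`; `.zero` (the trivial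
  profile: non-vacuity/API).
* Constants (data with locators): `hou2026_nu0 = 0.006`, `hou2026_dimension = 3.188`,
  `hou2026_collapseExponent = 0.5233`, `hou2026_R0 = 3.6927`, `hou2026_aspectRatio = 0.914`.

## WHAT THIS IS NOT

Hou 2023/2026 report NUMERICAL computations; nothing here asserts that any solution of
Navier–Stokes (or of the generalized system) blows up or is self-similar. The typed objects are
(i) exact algebra of the rescaling ansatz, (ii) the profile SYSTEM as a predicate (no existence
claim), (iii) printed parameters as real numbers. In particular `tendsto_hou2026_viscosity_zero`
records that the reported scenario has PHYSICAL viscosity `ν₀(T−t)^{0.0466} → 0`, i.e. is not a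
constant-`ν` Navier–Stokes computation (Hou 2026 §1.1; cf. the cell's SELFSIM-NOGO (M9)(ii)), and
the dimension is `n = 3.188 ≠ 3`. Hou 2023 (arXiv:2107.06509) switches `ν = 5·10⁻⁴ → 5·10⁻³` at
`t₀ = 0.00227375` (§3, p. 7) and reports the fits `‖u‖_∞ ∼ (T−t)^{-1/2}`, `Z(t) ∼ (T−t)^{1/2}`,
`‖ω‖_∞ ∼ |log(T−t)|/(T−t)` as "qualitative in nature" (§3.4, Remark p. 12); in the axisymmetric class
a genuine rate `‖u‖_∞ ≤ C(T−t)^{-1/2}` is excluded by the tree's `knss_no_axisymmetric_typeI_holds`.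

## Mathlib / tree search

Tree: `GeneralizedAxisymNS.lean` (§1–§2 of Hou 2026: `derivR`, `derivZ`, `GeneralizedAxisymNS.lap`,
`radialVel`, `axialVel`, the time-dependent system), `DynamicRescalingBlowup.lean` (Chen–Hou's
one-factor rescaling `t = ∫ C_ω`; Hou's `t = ∫ C_ψ C_lz` is the two-factor variant, typed here for
constant exponents), `SelfSimilarCollapseAnsatz.lean` (proposed: `effectiveViscosity`, the same law
from the physical side). `lean search 'HouScaling|twoScale|physicalViscosity|selfSimilarProfile'`:
nothing else. Mathlib: `Real.exp`, `Real.log`, `Real.rpow` calculus.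
-/

noncomputable section

open Set Filter Topology
open scoped ContDiff

namespace Literature.Analysis.FluidPDE

/-! ### The five scaling exponents and the rescaling relationship -/

/-- **Hou's scaling exponents** (constant values of the five scaling parameters of the two-scale
dynamic rescaling formulation, arXiv:2405.10916 §3): `c_lz, c_lr` (axial/radial length), `c_u`,
`c_ψ`, `c_ω` (amplitudes of `ũ₁, ψ̃₁, ω̃₁`), subject to "the rescaling relationship
`c_ψ = c_u + c_lz`, `c_ω = c_u − c_lz`". [cite: Hou2026, §3 (rescaling relationship)] -/
structure HouScalingExponents where
  /-- axial length exponent `c_lz` (`C_lz = e^{−∫c_lz}`) -/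
  clz : ℝ
  /-- radial length exponent `c_lr` (`C_lr = e^{−∫c_lr}`) -/
  clr : ℝ
  /-- amplitude exponent of `ũ₁` (`C_u = e^{∫c_u}`) -/
  cu : ℝ
  /-- amplitude exponent of `ψ̃₁` -/
  cψ : ℝ
  /-- amplitude exponent of `ω̃₁` -/
  cω : ℝ
  /-- rescaling relationship, first half: `c_ψ = c_u + c_lz` -/
  cψ_eq : cψ = cu + clz
  /-- rescaling relationship, second half: `c_ω = c_u − c_lz` -/
  cω_eq : cω = cu - clz

namespace HouScalingExponents

variable (e : HouScalingExponents)

/-- The rate `κ := c_lz − c_ψ` (`= −c_u` by the rescaling relationship); Hou's blow-up time is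
`T = 1/κ` and `τ = log(1/(T−t))/κ`. [cite: Hou2026, §3 (T = 1/(c_lz − c_ψ))] -/
def kappa : ℝ := e.clz - e.cψ

/-- `κ = −c_u`. [cite: Hou2026, §3 (rescaling relationship)] -/
theorem kappa_eq_neg_cu : e.kappa = -e.cu := by
  rw [kappa, e.cψ_eq]; ring

/-- `κ ≠ 0 ↔ c_u ≠ 0`. [cite: Hou2026, §3 (rescaling relationship)] -/
theorem cu_ne_zero (hκ : e.kappa ≠ 0) : e.cu ≠ 0 := by
  intro h; apply hκ; rw [kappa_eq_neg_cu, h, neg_zero]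

/-- The **normalized exponent** `ĉ = c/κ = c/(c_lz − c_ψ)` of a scaling parameter `c`
(`ĉ_lz = c_lz/(c_lz − c_ψ)`, `ĉ_lr`, `ĉ_ω`, `ĉ_ψ` in Hou's notation). [cite: Hou2026, §3 (normalized scaling exponents)] -/
def hat (c : ℝ) : ℝ := c / e.kappa

/-- `ĉ_u = −1` (the printed rate "`1/C_u = 1/(T−t)`"), for `κ ≠ 0`. [cite: Hou2026, §3 (1/C_u = 1/(T−t))] -/
theorem hat_cu (hκ : e.kappa ≠ 0) : e.hat e.cu = -1 := by
  rw [hat, kappa_eq_neg_cu, div_neg, div_self (e.cu_ne_zero hκ)]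

/-- `ĉ_ω = −1 − ĉ_lz` (printed), for `κ ≠ 0`. [cite: Hou2026, §3 (ĉ_ω = −1 − ĉ_lz)] -/
theorem hat_cω (hκ : e.kappa ≠ 0) : e.hat e.cω = -1 - e.hat e.clz := by
  have hcu := e.cu_ne_zero hκ
  rw [hat, hat, e.cω_eq, kappa_eq_neg_cu]
  field_simp
  ring

/-- `ĉ_ψ = −1 + ĉ_lz` (printed), for `κ ≠ 0`. [cite: Hou2026, §3 (ĉ_ψ = −1 + ĉ_lz)] -/
theorem hat_cψ (hκ : e.kappa ≠ 0) : e.hat e.cψ = -1 + e.hat e.clz := by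
  have hcu := e.cu_ne_zero hκ
  rw [hat, hat, e.cψ_eq, kappa_eq_neg_cu]
  field_simp
  ring

/-! ### Constant-exponent rescaling factors, rescaled time and the blow-up time -/

/-- The rescaling factor `e^{cτ}` of a constant exponent `c` (Hou §3: `C_ψ(τ) = e^{c_ψτ}`,
`C_lz(τ) = e^{−c_lzτ}`; so `C_u = factor c_u`, `C_ω = factor c_ω`, `C_ψ = factor c_ψ`,
`C_lr = factor (−c_lr)`, `C_lz = factor (−c_lz)`). [cite: Hou2026, §3 (C_ψ(τ) = e^{c_ψ τ}, C_lz(τ) = e^{−c_lz τ})] -/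
def factor (c τ : ℝ) : ℝ := Real.exp (c * τ)

/-- Unfolding `factor`. [cite: Hou2026, §3 (C_ψ(τ) = e^{c_ψ τ})] -/
@[simp] theorem factor_apply (c τ : ℝ) : factor c τ = Real.exp (c * τ) := rfl

/-- `C_ψ(τ) C_lz(τ) = e^{−κτ}`. [cite: Hou2026, §3 (t(τ) = ∫ C_ψ C_lz)] -/
theorem factor_cψ_mul_factor_neg_clz (τ : ℝ) :
    factor e.cψ τ * factor (-e.clz) τ = Real.exp (-e.kappa * τ) := by
  rw [factor_apply, factor_apply, ← Real.exp_add, kappa]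
  ring_nf

/-- Hou's **rescaled physical time** for constant exponents:
`t(τ) = ∫₀^τ C_ψ C_lz = (e^{(c_ψ−c_lz)τ} − 1)/(c_ψ − c_lz) = (1 − e^{−κτ})/κ` (defined by the closed
form; `hasDerivAt_time` is the printed `dt/dτ = C_ψ C_lz`, `time_zero` the normalisation).
Junk for `κ = 0`. [cite: Hou2026, §3 (t(τ) = (e^{(c_ψ−c_lz)τ} − 1)/(c_ψ − c_lz))] -/
def time (τ : ℝ) : ℝ := (1 - Real.exp (-e.kappa * τ)) / e.kappa

/-- `t(0) = 0`. [cite: Hou2026, §3 (t(τ) = ∫₀^τ C_ψ C_lz)] -/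
theorem time_zero : e.time 0 = 0 := by simp [time]

/-- The closed form equals the printed one: `t(τ) = (e^{(c_ψ−c_lz)τ} − 1)/(c_ψ − c_lz)`. [cite: Hou2026, §3 (t(τ) = (e^{(c_ψ−c_lz)τ} − 1)/(c_ψ − c_lz))] -/
theorem time_eq_printed (τ : ℝ) :
    e.time τ = (Real.exp ((e.cψ - e.clz) * τ) - 1) / (e.cψ - e.clz) := by
  rw [time, kappa, show -(e.clz - e.cψ) * τ = (e.cψ - e.clz) * τ by ring,
    show e.clz - e.cψ = -(e.cψ - e.clz) by ring, div_neg, neg_div', neg_sub]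

/-- **`dt/dτ = C_ψ C_lz`** (printed: "`τ` is the rescaled time variable satisfying
`dτ/dt = (C_ψC_lz)⁻¹`"), for `κ ≠ 0`. [cite: Hou2026, §3 (dτ/dt = (C_ψ C_lz)⁻¹)] -/
theorem hasDerivAt_time (hκ : e.kappa ≠ 0) (τ : ℝ) :
    HasDerivAt e.time (factor e.cψ τ * factor (-e.clz) τ) τ := by
  rw [factor_cψ_mul_factor_neg_clz]
  have h1 : HasDerivAt (fun s : ℝ => -e.kappa * s) (-e.kappa) τ := by
    simpa using (hasDerivAt_id τ).const_mul (-e.kappa)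
  have h2 : HasDerivAt (fun s : ℝ => Real.exp (-e.kappa * s)) (Real.exp (-e.kappa * τ) * -e.kappa) τ :=
    h1.exp
  have h3 := (h2.const_sub 1).div_const e.kappa
  have h4 : -(Real.exp (-e.kappa * τ) * -e.kappa) / e.kappa = Real.exp (-e.kappa * τ) := by
    rw [mul_neg, neg_neg, mul_div_cancel_right₀ _ hκ]
  rw [h4] at h3
  exact h3

/-- Hou's **blow-up time** `T = 1/(c_lz − c_ψ) = 1/κ` (the limit of `t(τ)` as `τ → ∞` when
`κ > 0`). [cite: Hou2026, §3 (T = 1/(c_lz − c_ψ))] -/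
def blowupTime : ℝ := 1 / e.kappa

/-- `T − t(τ) = e^{−κτ}/κ`. [cite: Hou2026, §3 (τ = log(1/(T−t))/(c_lz − c_ψ))] -/
theorem blowupTime_sub_time (hκ : e.kappa ≠ 0) (τ : ℝ) :
    e.blowupTime - e.time τ = Real.exp (-e.kappa * τ) / e.kappa := by
  rw [blowupTime, time]
  field_simp
  ring

/-- `κ (T − t(τ)) = e^{−κτ}` (positive). [cite: Hou2026, §3 (τ = log(1/(T−t))/(c_lz − c_ψ))] -/
theorem kappa_mul_sub_time (hκ : e.kappa ≠ 0) (τ : ℝ) :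
    e.kappa * (e.blowupTime - e.time τ) = Real.exp (-e.kappa * τ) := by
  rw [blowupTime_sub_time e hκ]
  field_simp

/-- `t(τ) → T` as `τ → ∞` when `κ > 0` (finite-time blow-up in physical time).
[cite: Hou2026, §3 (T = 1/(c_lz − c_ψ))] -/
theorem tendsto_time_blowupTime (hκ : 0 < e.kappa) :
    Tendsto e.time atTop (𝓝 e.blowupTime) := by
  have h1 : Tendsto (fun τ => Real.exp (-e.kappa * τ) / e.kappa) atTop (𝓝 (0 / e.kappa)) := by
    refine Tendsto.div_const ?_ _
    have : Tendsto (fun τ : ℝ => -e.kappa * τ) atTop atBot :=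
      tendsto_id.const_mul_atTop_of_neg (by linarith)
    exact Real.tendsto_exp_atBot.comp this
  rw [zero_div] at h1
  have h2 : e.time = fun τ => e.blowupTime - Real.exp (-e.kappa * τ) / e.kappa := by
    funext τ; have := e.blowupTime_sub_time hκ.ne' τ; linarith
  rw [h2]
  simpa using tendsto_const_nhds.sub h1

/-- **`τ = log(1/(T−t))/κ`** with the constant made explicit: `τ = log(1/(κ(T − t(τ))))/κ`
(printed with `κ(T−t)` abbreviated to `T−t`). [cite: Hou2026, §3 (τ = log(1/(T−t))/(c_lz − c_ψ))] -/
theorem tau_eq_log (hκ : e.kappa ≠ 0) (τ : ℝ) :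
    τ = Real.log (1 / (e.kappa * (e.blowupTime - e.time τ))) / e.kappa := by
  rw [kappa_mul_sub_time e hκ, one_div, Real.log_inv, Real.log_exp]
  field_simp

/-! ### The power laws of the rescaling factors in physical time -/

/-- **`C_lz(τ) = (T−t)^{ĉ_lz}`** with the constant made explicit: `C_lz = (κ(T − t))^{ĉ_lz}`.
[cite: Hou2026, §3 (C_lz(τ) = (T−t)^{ĉ_lz})] -/
theorem factor_neg_clz_eq_rpow (hκ : e.kappa ≠ 0) (τ : ℝ) :
    factor (-e.clz) τ = (e.kappa * (e.blowupTime - e.time τ)) ^ e.hat e.clz := by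
  rw [kappa_mul_sub_time e hκ, factor_apply, ← Real.exp_mul, hat]
  congr 1
  field_simp

/-- The same for the radial factor: `C_lr = (κ(T − t))^{ĉ_lr}`. [cite: Hou2026, §3 (C_lr(τ) = (T−t)^{ĉ_lr})] -/
theorem factor_neg_clr_eq_rpow (hκ : e.kappa ≠ 0) (τ : ℝ) :
    factor (-e.clr) τ = (e.kappa * (e.blowupTime - e.time τ)) ^ e.hat e.clr := by
  rw [kappa_mul_sub_time e hκ, factor_apply, ← Real.exp_mul, hat]
  congr 1
  field_simp

/-- A general exponent: `e^{cτ} = (κ(T−t))^{−ĉ}`. [cite: Hou2026, §3 (normalized scaling exponents)] -/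
theorem factor_eq_rpow (hκ : e.kappa ≠ 0) (c τ : ℝ) :
    factor c τ = (e.kappa * (e.blowupTime - e.time τ)) ^ (-e.hat c) := by
  rw [kappa_mul_sub_time e hκ, factor_apply, ← Real.exp_mul, hat]
  congr 1
  field_simp

/-- **Blow-up rate of `ũ₁`'s amplitude: `1/C_u = 1/(T−t)`** (with the constant: `(κ(T−t))⁻¹`).
[cite: Hou2026, §3 (1/C_u = 1/(T−t))] -/
theorem inv_factor_cu (hκ : e.kappa ≠ 0) (τ : ℝ) :
    (factor e.cu τ)⁻¹ = (e.kappa * (e.blowupTime - e.time τ))⁻¹ := by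
  rw [factor_eq_rpow e hκ, hat_cu e hκ, neg_neg, Real.rpow_one]

/-- **`1/C_ω = 1/(T−t)^{1+ĉ_lz}`** (with the constant `κ`). [cite: Hou2026, §3 (1/C_ω = 1/(T−t)^{1+ĉ_lz})] -/
theorem inv_factor_cω (hκ : e.kappa ≠ 0) (τ : ℝ) :
    (factor e.cω τ)⁻¹ = ((e.kappa * (e.blowupTime - e.time τ)) ^ (1 + e.hat e.clz))⁻¹ := by
  rw [factor_eq_rpow e hκ, hat_cω e hκ, show -(-1 - e.hat e.clz) = 1 + e.hat e.clz by ring]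

/-- **`1/C_ψ = 1/(T−t)^{1−ĉ_lz}`** (with the constant `κ`). [cite: Hou2026, §3 (1/C_ψ = 1/(T−t)^{1−ĉ_lz})] -/
theorem inv_factor_cψ (hκ : e.kappa ≠ 0) (τ : ℝ) :
    (factor e.cψ τ)⁻¹ = ((e.kappa * (e.blowupTime - e.time τ)) ^ (1 - e.hat e.clz))⁻¹ := by
  rw [factor_eq_rpow e hκ, hat_cψ e hκ, show -(-1 + e.hat e.clz) = 1 - e.hat e.clz by ring]

/-! ### The solution-dependent viscosity law -/

/-- **Hou's physical viscosity in terms of the rescaling factors**: the choice that makes the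
RESCALED viscosity the constant `ν₀`, i.e. `νC_ψ/C_lz = ν₀` (§3), is `ν(τ) = ν₀ C_lz/C_ψ` (§1.1:
"`ν = ν₀‖u₁(t)‖_∞Z(t)²` … this solution dependent viscosity is scaling invariant").
[cite: Hou2026, §3 (νC_ψ/C_lz = ν₀) and §1.1] -/
def physicalViscosity (ν₀ τ : ℝ) : ℝ := ν₀ * factor (-e.clz) τ / factor e.cψ τ

/-- The defining property `ν C_ψ / C_lz = ν₀`. [cite: Hou2026, §3 (νC_ψ/C_lz = ν₀)] -/
theorem physicalViscosity_mul_div (ν₀ τ : ℝ) :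
    e.physicalViscosity ν₀ τ * factor e.cψ τ / factor (-e.clz) τ = ν₀ := by
  have h1 : factor e.cψ τ ≠ 0 := (Real.exp_pos _).ne'
  have h2 : factor (-e.clz) τ ≠ 0 := (Real.exp_pos _).ne'
  rw [physicalViscosity]
  field_simp

/-- **`ν = ν₀(T−t)^{2c_l−1}`** (§1.1, with the constant `κ` explicit and `c_l` = the normalized
exponent `ĉ_lz`): `ν(τ) = ν₀ (κ(T − t(τ)))^{2ĉ_lz − 1}`. [cite: Hou2026, §1.1 (ν = ν₀(T−t)^{2c_l−1})] -/
theorem physicalViscosity_eq_rpow (hκ : e.kappa ≠ 0) (ν₀ τ : ℝ) :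
    e.physicalViscosity ν₀ τ =
      ν₀ * (e.kappa * (e.blowupTime - e.time τ)) ^ (2 * e.hat e.clz - 1) := by
  have hpos : 0 < e.kappa * (e.blowupTime - e.time τ) := by
    rw [kappa_mul_sub_time e hκ]; exact Real.exp_pos _
  rw [physicalViscosity, factor_neg_clz_eq_rpow e hκ, factor_eq_rpow e hκ, hat_cψ e hκ, mul_div_assoc,
    ← Real.rpow_sub hpos]
  ring_nf

/-- The physical viscosity of the rescaled-constant-viscosity scenario is time independent iff
`ĉ_lz = ½` (exponent `2ĉ_lz − 1 = 0`: then `ν ≡ ν₀`), which is the parabolic (Leray/Navier–Stokes)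
scaling; Hou: "we expect to have `c_l → 1/2` and `n → 3` in the limit `ν₀ → 0`". [cite: Hou2026, §3 (c_l → 1/2 as ν₀ → 0) and §1.1] -/
theorem physicalViscosity_const_of_hat_half (hκ : e.kappa ≠ 0) (h : e.hat e.clz = 1 / 2) (ν₀ τ : ℝ) :
    e.physicalViscosity ν₀ τ = ν₀ := by
  rw [physicalViscosity_eq_rpow e hκ, h]
  norm_num

/-- For `ĉ_lz > ½` and `κ > 0` the physical viscosity tends to `0` at the blow-up time
(`τ → ∞`): the scenario's viscosity vanishes in the limit, so it is not a constant-viscosity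
Navier–Stokes computation. [cite: Hou2026, §1.1 (ν = ν₀(T−t)^{2c_l−1}, c_l = 0.5233)] -/
theorem tendsto_physicalViscosity_zero (hκ : 0 < e.kappa) (h : 1 / 2 < e.hat e.clz) (ν₀ : ℝ) :
    Tendsto (e.physicalViscosity ν₀) atTop (𝓝 0) := by
  have hne := hκ.ne'
  have h1 : ∀ τ, e.physicalViscosity ν₀ τ = ν₀ * Real.exp (-(e.kappa * (2 * e.hat e.clz - 1)) * τ) := by
    intro τ
    rw [physicalViscosity_eq_rpow e hne, kappa_mul_sub_time e hne, ← Real.exp_mul]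
    ring_nf
  rw [show e.physicalViscosity ν₀ = fun τ => ν₀ * Real.exp (-(e.kappa * (2 * e.hat e.clz - 1)) * τ)
    from funext h1]
  have h2 : Tendsto (fun τ : ℝ => -(e.kappa * (2 * e.hat e.clz - 1)) * τ) atTop atBot :=
    tendsto_id.const_mul_atTop_of_neg (by nlinarith)
  simpa using (Real.tendsto_exp_atBot.comp h2).const_mul ν₀

end HouScalingExponents

/-! ### The steady self-similar profile system (one scale, constant rescaled viscosity) -/

/-- **Hou's self-similar profile system** for the generalized `n`-dimensional axisymmetric
Navier–Stokes equations (arXiv:2405.10916 §3: the steady state of the two-scale dynamic rescaling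
equations in the one-scale regime `δ = 1`, `c_lr = c_lz = c_l`, with constant rescaled viscosity
`ν₀` — "the dynamic rescaling formulation is the same as that for the generalized axisymmetric
Navier–Stokes equations with a constant viscosity `ν₀` … If the solution of the dynamic rescaling
equations converges to a steady state, the steady state satisfies the following self-similar
equations"), written in the primary unknowns `(ũ₁, ω̃₁, ψ̃₁) = (U, Ω, Ψ)` of the rescaled system
displayed in §3 (the `Γ̃ = ξ²ũ₁` form printed for the steady state is equivalent, cf.
`GeneralizedAxisymNS.circulation_eq_iff`), on the meridian half-plane `q = (ξ, η)`, `ξ > 0`: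

* `c_l ξ U_ξ + c_l η U_η + ũ^ξ U_ξ + ũ^η U_η = c_u U + 2UΨ_η + ν₀ L_n U`,
* `c_l ξ Ω_ξ + c_l η Ω_η + ũ^ξ Ω_ξ + ũ^η Ω_η = c_ω Ω + (U²)_η − (n−3)Ψ_η Ω + ν₀ L_n Ω`, `c_ω = c_u − c_l`,
* `−L_n Ψ = Ω`, with `ũ^ξ = −ξΨ_η`, `ũ^η = (n−1)Ψ + ξΨ_ξ`, `L_n = ∂_ξξ + (n/ξ)∂_ξ + ∂_ηη`
  (`GeneralizedAxisymNS.radialVel/axialVel/lap`),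

profiles smooth and even in `ξ` (the parity of §2.1). Hou normalises `‖U‖_∞ = 1` attained at
`(R₀, 1)`, `R₀ = 3.6927` (not imposed here: a predicate on `(n, ν₀, c_l, c_u, U, Ω, Ψ)`, no existence
claim). [cite: Hou2026, §3 (self-similar equations of the steady state)] -/
structure HouSelfSimilarProfile (n ν₀ cl cu : ℝ) (U Ω Ψ : ℝ × ℝ → ℝ) : Prop where
  /-- `U = ũ₁` is smooth. -/
  smooth_U : ContDiff ℝ ∞ U
  /-- `Ω = ω̃₁` is smooth. -/
  smooth_Ω : ContDiff ℝ ∞ Ω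
  /-- `Ψ = ψ̃₁` is smooth. -/
  smooth_Ψ : ContDiff ℝ ∞ Ψ
  /-- `U` is even in `ξ`. -/
  even_U : ∀ ξ η : ℝ, U (-ξ, η) = U (ξ, η)
  /-- `Ω` is even in `ξ`. -/
  even_Ω : ∀ ξ η : ℝ, Ω (-ξ, η) = Ω (ξ, η)
  /-- `Ψ` is even in `ξ`. -/
  even_Ψ : ∀ ξ η : ℝ, Ψ (-ξ, η) = Ψ (ξ, η)
  /-- the `ũ₁`-equation of the steady rescaled system (amplitude exponent `c_u`) -/
  swirl_eq : ∀ q : ℝ × ℝ, 0 < q.1 →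
    cl * q.1 * derivR U q + cl * q.2 * derivZ U q +
        GeneralizedAxisymNS.radialVel Ψ q * derivR U q +
        GeneralizedAxisymNS.axialVel n Ψ q * derivZ U q =
      cu * U q + 2 * U q * derivZ Ψ q + ν₀ * GeneralizedAxisymNS.lap n U q
  /-- the `ω̃₁`-equation (amplitude exponent `c_ω = c_u − c_l` by the rescaling relationship) -/
  vorticity_eq : ∀ q : ℝ × ℝ, 0 < q.1 →
    cl * q.1 * derivR Ω q + cl * q.2 * derivZ Ω q +
        GeneralizedAxisymNS.radialVel Ψ q * derivR Ω q +
        GeneralizedAxisymNS.axialVel n Ψ q * derivZ Ω q =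
      (cu - cl) * Ω q + derivZ (fun q' => U q' ^ 2) q - (n - 3) * derivZ Ψ q * Ω q +
        ν₀ * GeneralizedAxisymNS.lap n Ω q
  /-- the elliptic equation `−L_n Ψ = Ω` -/
  stream_eq : ∀ q : ℝ × ℝ, 0 < q.1 → -GeneralizedAxisymNS.lap n Ψ q = Ω q

namespace HouSelfSimilarProfile

/-- `∂_ξ 0 = 0`. [folklore] -/
private theorem derivR_zero : derivR (0 : ℝ × ℝ → ℝ) = 0 := by
  funext q; simp [derivR]

/-- `∂_η 0 = 0`. [folklore] -/
private theorem derivZ_zero : derivZ (0 : ℝ × ℝ → ℝ) = 0 := by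
  funext q; simp [derivZ]

/-- The trivial profile solves the system (non-vacuity of the predicate; Hou's computed profile is
of course nontrivial, `‖U‖_∞ = 1`). [cite: Hou2026, §3 (self-similar equations of the steady state)] -/
theorem zero (n ν₀ cl cu : ℝ) : HouSelfSimilarProfile n ν₀ cl cu 0 0 0 := by
  refine ⟨contDiff_const, contDiff_const, contDiff_const, fun _ _ => rfl, fun _ _ => rfl,
    fun _ _ => rfl, ?_, ?_, ?_⟩ <;> intro q _ <;>
    simp [derivR_zero, derivZ_zero, derivR, derivZ, GeneralizedAxisymNS.lap,
      GeneralizedAxisymNS.radialVel, GeneralizedAxisymNS.axialVel]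

end HouSelfSimilarProfile

/-! ### Printed parameters of Hou's computations (data with locators) -/

section Constants

/-- **`ν₀ = 0.006`**: the constant of the solution-dependent viscosity
`ν = ν₀‖u₁(t)‖_∞Z(t)²` (arXiv:2405.10916 §1.1). Data. [cite: Hou2026, §1.1 (ν₀ = 0.006)] -/
def hou2026_nu0 : ℝ := 0.006

/-- **`n ≈ 3.188`**: the reported limiting dimension of the generalized axisymmetric
Navier–Stokes blow-up ("self-similar blowup with dimension equal to `3.188`", abstract and §1.1).
Data; note `n ≠ 3`. [cite: Hou2026, §1.1 (n ≈ 3.188)] -/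
def hou2026_dimension : ℝ := 3.188

/-- **`c_l = 0.5233`**: the reported physical collapse exponent, "`λ(t)√(T−t) ≡ (T−t)^{c_l}`, then we
have `c_l = 0.5233`" (`λ(t) ≈ (T−t)^{0.0233}`), §1.1. Data. [cite: Hou2026, §1.1 (c_l = 0.5233)] -/
def hou2026_collapseExponent : ℝ := 0.5233

/-- **`R₀ = 3.6927`**: the normalisation point, "`ũ₁` achieves its maximum at `(ξ,η) = (R₀, 1)` with
`R₀ = 3.6927` and `‖ũ₁‖_∞` being fixed to be `1`" (§3). Data. [cite: Hou2026, §3 (R₀ = 3.6927)] -/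
def hou2026_R0 : ℝ := 3.6927

/-- **`λ₀ ≈ 0.914`**: the limiting aspect ratio `δ = C_lz/C_lr → λ₀` of the two-scale rescaling
("In our computation, we obtain `λ₀ ≈ 0.914`", §3). Data. [cite: Hou2026, §3 (λ₀ ≈ 0.914)] -/
def hou2026_aspectRatio : ℝ := 0.914

/-- The reported exponent exceeds the parabolic value: `½ < 0.5233`, so `2c_l − 1 = 0.0466 > 0`.
[cite: Hou2026, §1.1 (c_l = 0.5233)] -/
theorem half_lt_hou2026_collapseExponent : (1 / 2 : ℝ) < hou2026_collapseExponent := by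
  rw [hou2026_collapseExponent]; norm_num

/-- **WHAT THE REPORTED SCENARIO IS NOT**: with the printed `c_l = 0.5233` the physical viscosity
`ν = ν₀(T−t)^{2c_l−1} = ν₀(T−t)^{0.0466}` of Hou's solution-dependent-viscosity computation tends to
`0` as `t ↑ T` — it is not a constant-viscosity Navier–Stokes solution (Hou §3: "we expect to have
`c_l → 1/2` and `n → 3` in the limit `ν₀ → 0`"). [cite: Hou2026, §1.1 (ν = ν₀(T−t)^{2c_l−1}, c_l = 0.5233)] -/
theorem tendsto_hou2026_viscosity_zero (T : ℝ) :
    Tendsto (fun t => hou2026_nu0 * (T - t) ^ (2 * hou2026_collapseExponent - 1)) (𝓝[<] T) (𝓝 0) := by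
  have hexp : 0 < 2 * hou2026_collapseExponent - 1 := by
    rw [hou2026_collapseExponent]; norm_num
  have h1 : Tendsto (fun t : ℝ => T - t) (𝓝[<] T) (𝓝 0) := by
    have : Tendsto (fun t : ℝ => T - t) (𝓝 T) (𝓝 (T - T)) :=
      (continuous_const.sub continuous_id).tendsto T
    rw [sub_self] at this
    exact this.mono_left nhdsWithin_le_nhds
  have h2 : ContinuousAt (fun s : ℝ => s ^ (2 * hou2026_collapseExponent - 1)) 0 :=
    Real.continuousAt_rpow_const 0 _ (Or.inr hexp.le)
  have h3 := h2.tendsto.comp h1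
  rw [Function.comp_def, Real.zero_rpow hexp.ne'] at h3
  simpa using h3.const_mul hou2026_nu0

end Constants

end Literature.Analysis.FluidPDE
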